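import Literature.Barriers.FinalStateConjecture.KleinGordonSuperradiantInstabilityInputs
import HarnessLib

/-!
# Barrier catalogue `FinalStateConjecture`: Shlapentokh-Rothman's superradiant instability —
# separation of variables: mode solutions in the sense of SR §2, and the proved reduction of the
# barrier to their existence (Thm. 1.2 at the level of the printed ODEs)

`KleinGordonSuperradiantInstabilityProofs.lean` reduces the barrier fact
`KleinGordonSuperradiantInstability` (SR, CMP 329 (2014), Thm. 1.1, energy form) to the named fact
`ShlapentokhRothman2014_unstableModeProfile`: a profile `Φ` on the Kerr–Schild leaf, smooth, decaying,
non-zero, with `P_ω Φ = μ² Φ` (`reducedWaveOp`). This file carries the reduction one level further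
down, to **Shlapentokh-Rothman's theorem about the ordinary differential equations (2.1)–(2.2)**:

* the structure `ModeSolution M a μ ω m` — a mode solution in the sense of §2 with parameters
  `(ω, m, μ)`: a separation constant `λ`, an angular function `S` solving the angular ODE (2.1) on
  `(0, π)` with `e^{imφ}S(θ)` extending smoothly to `𝕊²`, and a radial function `R` solving the
  radial ODE (2.2) on `(r₊, ∞)` with the horizon behaviour (2.3) (`R = e^{−i(ωt̄ − mφ̄)} f`, `f`
  smooth up to `r₊`) and exponential decay at infinity (finite energy (2.5) and the third appendix),
  as printed (docstring of the structure). Theorem 1.2 of the paper (with the mass clause of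
  Thm. 1.1) is the existence of such mode solutions with `Im ω > 0`, `Re ω ≠ 0`, superradiant, for
  masses near `|am|/(2Mr₊)`; it enters below as an explicit HYPOTHESIS and is deliberately not
  vendored as a named fact by this proving unit (D-0026);
* the **Kerr–Schild profile of the printed mode**, `modeProfile a ω f 𝒮 (y) = e^{−iωr(y)} f(r(y)) 𝒮(ℓ⃗(y))`
  (`r(y)` the Kerr–Schild radius, `ℓ⃗(y)` the spatial null vector = `n̂(θ, φ_KS)` of the Kerr-star
  angles of `y`, `𝒮(n̂(θ, φ)) = e^{imφ} S(θ)`): this is `e^{iωt_KS} × (e^{−iωt} e^{imφ} S(θ) R(r))`,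
  the printed mode written in the ingoing Kerr–Schild chart (`t = t_KS + r − t̄`, `φ = φ_KS − φ̄`);
* the **proof** that for a mode solution this profile has all the properties required by
  `ShlapentokhRothman2014_unstableModeProfile`
  (`ShlapentokhRothman2014_unstableModeProfile.of_modeSolutions`):
  smoothness on the exterior slice (`contDiffOn_modeProfile`), non-vanishing, exponential decay with
  its differential (`modeProfile_decay`, from `ingoing_bounds` and the geometric bounds of
  `…Inputs.lean`), and the reduced equation `P_ω Φ = μ² Φ` on the whole slice
  (`reducedWaveOp_modeProfile`): off the axis by **Carter's separation of variables** in Kerr's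
  ingoing spheroidal coordinates — `reducedWaveOp_kerrStar` (`…Inputs.lean`) applied to the
  separated function `Φ(Y_a(s, t, p)) = u(s) e^{imp} S(t)`, `u = e^{−iωs} f`
  (`IsSeparatedNear`, `reducedWaveOp_of_separated`), the angular ODE (2.1) and the ingoing radial ODE
  for `u` (`ingoingRadial_of_radialODE`, the conjugate of (2.2) under (2.3)) recombining to
  `Σ P_ω Φ = μ² Σ Φ` (`reducedWaveOp_eq_mass_of_separated`) — and on the axis `{x = y = 0}` by
  continuity (`continuousOn_reducedWaveOp`, `Kerr.eqOn_slice_of_offAxis`);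
* the corollary `KleinGordonSuperradiantInstability.of_modeSolutions`.

So what separates the barrier from a theorem is now exactly the ODE analysis of the paper (angular
eigenvalue curves, local theory at `r₊` and at infinity, variational real modes, implicit-function
perturbation into `Im ω > 0`, i.e. the existence of `ModeSolution`s with the parameters of
Thm. 1.2); everything between those ODEs and the barrier statement on the prelude's Kerr spacetime is
proved here.

## References
* Y. Shlapentokh-Rothman, *Exponentially growing finite energy solutions for the Klein–Gordon
  equation on sub-extremal Kerr spacetimes*, CMP 329 (2014) 859–891, arXiv:1302.3448: Thm. 1.1,
  Thm. 1.2, §1.2.1, §1.3 (1.5), §2 ((2.1)–(2.5)), §3.1, the three appendices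
  (key `ShlapentokhRothman2014KleinGordon`; numbering of the held copy `paper:arxiv-1302.3448`).
* B. Carter, Comm. Math. Phys. 10 (1968) 280–310 (separability of the wave equation on Kerr), as used
  in SR §2.
* M. Visser, arXiv:0706.0622, §4 (Kerr's ingoing coordinates) (key `arXiv07060622`).
-/

noncomputable section

open Set Filter Topology Real Metric Laplacian
open scoped ContDiff

namespace Literature.Barriers.FinalStateConjecture

open Literature.Geometry.Lorentzian Literature.Geometry.Lorentzian.Kerr

/-! ### Separated functions `u(r) e^{imφ} S(θ)`: their coordinate derivatives -/

section Separated

/-- The azimuthal phase `e^{imφ}` as a function of the real variable `φ`. SR, CMP 329 (2014), (1.5).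
[cite: ShlapentokhRothman2014KleinGordon, §1.3 (1.5)] -/
def azPhase (m : ℤ) (p : ℝ) : ℂ := Complex.exp ((m : ℂ) * (p : ℂ) * Complex.I)

/-- `d/dφ e^{imφ} = im e^{imφ}`. [folklore] -/
theorem hasDerivAt_azPhase (m : ℤ) (p : ℝ) :
    HasDerivAt (azPhase m) ((m : ℂ) * Complex.I * azPhase m p) p := by
  have h1 : HasDerivAt (fun p : ℝ ↦ (m : ℂ) * (p : ℂ) * Complex.I) ((m : ℂ) * 1 * Complex.I) p :=
    ((Complex.ofRealCLM.hasDerivAt (x := p)).const_mul (m : ℂ)).mul_const Complex.I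
  have h2 := (Complex.hasDerivAt_exp ((m : ℂ) * (p : ℂ) * Complex.I)).comp p h1
  unfold azPhase
  exact h2.congr_deriv (by ring)

/-- `e^{imφ} ≠ 0`. [folklore] -/
theorem azPhase_ne_zero (m : ℤ) (p : ℝ) : azPhase m p ≠ 0 := Complex.exp_ne_zero _

/-- `|e^{imφ}| = 1`. [folklore] -/
theorem norm_azPhase (m : ℤ) (p : ℝ) : ‖azPhase m p‖ = 1 := by
  rw [azPhase, Complex.norm_exp]
  simp

/-- `e^{im·0} = 1`. [folklore] -/
theorem azPhase_zero (m : ℤ) : azPhase m 0 = 1 := by simp [azPhase]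

variable {G : ℝ → ℝ → ℝ → ℂ} {u S : ℝ → ℂ} {m : ℤ} {A B C : Set ℝ} {r θ φ : ℝ}

/-- A function `G(s, t, p)` which is separated, `G = u(s) e^{imp} S(t)`, on a box `A × B × C` of
neighbourhoods of `(r, θ, φ)`, with `u` and `S` of class `C²` at `r` and `θ` — the local form of a
mode `e^{−iωt} e^{imφ} S(θ) R(r)` read in coordinates (SR, CMP 329 (2014), (1.5) and §2).
[cite: ShlapentokhRothman2014KleinGordon, §1.3 (1.5) and §2] -/
structure IsSeparatedNear (G : ℝ → ℝ → ℝ → ℂ) (u S : ℝ → ℂ) (m : ℤ) (A B C : Set ℝ) (r θ φ : ℝ) :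
    Prop where
  /-- `A` is a neighbourhood of `r`. -/
  hA : A ∈ 𝓝 r
  /-- `B` is a neighbourhood of `θ`. -/
  hB : B ∈ 𝓝 θ
  /-- `C` is a neighbourhood of `φ`. -/
  hC : C ∈ 𝓝 φ
  /-- the separated form on the box -/
  eq : ∀ s ∈ A, ∀ t ∈ B, ∀ p ∈ C, G s t p = u s * (azPhase m p * S t)
  /-- the radial factor is `C²` at `r` -/
  hu : ContDiffAt ℝ 2 u r
  /-- the polar factor is `C²` at `θ` -/
  hS : ContDiffAt ℝ 2 S θ

namespace IsSeparatedNear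

variable (h : IsSeparatedNear G u S m A B C r θ φ)
include h

/-- The centre `r` lies in the box. [folklore] -/
theorem r_mem : r ∈ A := mem_of_mem_nhds h.hA

/-- The centre `θ` lies in the box. [folklore] -/
theorem θ_mem : θ ∈ B := mem_of_mem_nhds h.hB

/-- The centre `φ` lies in the box. [folklore] -/
theorem φ_mem : φ ∈ C := mem_of_mem_nhds h.hC

/-- Near `r`, `s ↦ G(s, θ, φ)` is `s ↦ u(s) · e^{imφ} S(θ)`. [folklore] -/
theorem eventuallyEq_r : (fun s ↦ G s θ φ) =ᶠ[𝓝 r] fun s ↦ u s * (azPhase m φ * S θ) := by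
  filter_upwards [h.hA] with s hs using h.eq s hs θ h.θ_mem φ h.φ_mem

/-- `∂_r G = u' e^{imφ} S`. [folklore] -/
theorem deriv_r : deriv (fun s ↦ G s θ φ) r = deriv u r * (azPhase m φ * S θ) := by
  rw [h.eventuallyEq_r.deriv_eq]
  exact ((h.hu.differentiableAt (by simp)).hasDerivAt.mul_const _).deriv

/-- Near `r`, `∂_r G(·, θ, φ) = u' e^{imφ} S(θ)`. [folklore] -/
theorem deriv_r_eventuallyEq :
    deriv (fun s ↦ G s θ φ) =ᶠ[𝓝 r] fun s ↦ deriv u s * (azPhase m φ * S θ) := by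
  have hev : ∀ᶠ s in 𝓝 r, ContDiffAt ℝ 2 u s := h.hu.eventually (by simp)
  have hev' : ∀ᶠ s in 𝓝 r, (fun s ↦ G s θ φ) =ᶠ[𝓝 s] fun s ↦ u s * (azPhase m φ * S θ) :=
    (eventually_eventuallyEq_nhds.2 h.eventuallyEq_r)
  filter_upwards [hev, hev'] with s hs hs'
  rw [hs'.deriv_eq]
  exact ((hs.differentiableAt (by simp)).hasDerivAt.mul_const _).deriv

/-- `∂_r ∂_r G = u'' e^{imφ} S`. [folklore] -/
theorem deriv_deriv_r : deriv (deriv (fun s ↦ G s θ φ)) r = deriv (deriv u) r * (azPhase m φ * S θ) := by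
  rw [h.deriv_r_eventuallyEq.deriv_eq]
  have hu2 : DifferentiableAt ℝ (deriv u) r :=
    (h.hu.derivWithin (m := 1) (by norm_num)).differentiableAt one_ne_zero
  exact (hu2.hasDerivAt.mul_const _).deriv

/-- `deriv u` is differentiable at `r`. [folklore] -/
theorem differentiableAt_deriv_u : DifferentiableAt ℝ (deriv u) r :=
  (h.hu.derivWithin (m := 1) (by norm_num)).differentiableAt one_ne_zero

/-- `deriv S` is differentiable at `θ`. [folklore] -/
theorem differentiableAt_deriv_S : DifferentiableAt ℝ (deriv S) θ :=
  (h.hS.derivWithin (m := 1) (by norm_num)).differentiableAt one_ne_zero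

/-- `∂_r((r² + a²)∂_r G) = (2r u' + (r² + a²)u'') e^{imφ} S`. [folklore] -/
theorem deriv_T1 (a : ℝ) :
    deriv (fun s ↦ (s ^ 2 + a ^ 2) • deriv (fun s' ↦ G s' θ φ) s) r =
      (2 * r * deriv u r + (r ^ 2 + a ^ 2) * deriv (deriv u) r) * (azPhase m φ * S θ) := by
  have hev : (fun s ↦ (s ^ 2 + a ^ 2) • deriv (fun s' ↦ G s' θ φ) s) =ᶠ[𝓝 r]
      fun s ↦ (s ^ 2 + a ^ 2) • (deriv u s * (azPhase m φ * S θ)) := by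
    filter_upwards [h.deriv_r_eventuallyEq] with s hs
    rw [hs]
  rw [hev.deriv_eq]
  have hsq : HasDerivAt (fun s : ℝ ↦ s ^ 2 + a ^ 2) (2 * r) r := by
    simpa using ((hasDerivAt_id r).pow 2).add_const (a ^ 2)
  rw [(hsq.fun_smul (h.differentiableAt_deriv_u.hasDerivAt.mul_const _)).deriv]
  simp only [Complex.real_smul]
  push_cast
  ring

/-- Near `θ`, `∂_θ G(r, ·, φ) = u(r) e^{imφ} S'`. [folklore] -/
theorem deriv_θ_eventuallyEq :
    deriv (fun t ↦ G r t φ) =ᶠ[𝓝 θ] fun t ↦ u r * (azPhase m φ * deriv S t) := by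
  have hevS : ∀ᶠ t in 𝓝 θ, ContDiffAt ℝ 2 S t := h.hS.eventually (by simp)
  have heq : (fun t ↦ G r t φ) =ᶠ[𝓝 θ] fun t ↦ u r * (azPhase m φ * S t) := by
    filter_upwards [h.hB] with t ht using h.eq r h.r_mem t ht φ h.φ_mem
  filter_upwards [hevS, eventually_eventuallyEq_nhds.2 heq] with t ht ht'
  rw [ht'.deriv_eq]
  exact (((ht.differentiableAt (by simp)).hasDerivAt.const_mul _).const_mul _).deriv

/-- `∂_θ(sin θ ∂_θ G) = u e^{imφ} (cos θ S' + sin θ S'')`. [folklore] -/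
theorem deriv_T2 :
    deriv (fun t ↦ sin t • deriv (fun t' ↦ G r t' φ) t) θ =
      u r * azPhase m φ * (cos θ * deriv S θ + sin θ * deriv (deriv S) θ) := by
  have hev : (fun t ↦ sin t • deriv (fun t' ↦ G r t' φ) t) =ᶠ[𝓝 θ]
      fun t ↦ sin t • (u r * (azPhase m φ * deriv S t)) := by
    filter_upwards [h.deriv_θ_eventuallyEq] with t ht
    rw [ht]
  rw [hev.deriv_eq, ((hasDerivAt_sin θ).fun_smul
    ((h.differentiableAt_deriv_S.hasDerivAt.const_mul _).const_mul _)).deriv]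
  simp only [Complex.real_smul]
  push_cast
  ring

/-- `∂_φ ∂_φ G = −m² u e^{imφ} S`. [folklore] -/
theorem deriv_T3 :
    deriv (fun p ↦ deriv (fun p' ↦ G r θ p') p) φ = -(m : ℂ) ^ 2 * (u r * (azPhase m φ * S θ)) := by
  have heq : (fun p ↦ G r θ p) =ᶠ[𝓝 φ] fun p ↦ u r * (azPhase m p * S θ) := by
    filter_upwards [h.hC] with p hp using h.eq r h.r_mem θ h.θ_mem p hp
  have hev : deriv (fun p' ↦ G r θ p') =ᶠ[𝓝 φ]
      fun p ↦ u r * ((m : ℂ) * Complex.I * azPhase m p * S θ) := by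
    filter_upwards [eventually_eventuallyEq_nhds.2 heq] with p hp
    rw [hp.deriv_eq]
    exact (((hasDerivAt_azPhase m p).mul_const _).const_mul _).deriv
  rw [hev.deriv_eq, ((((hasDerivAt_azPhase m φ).const_mul _).mul_const _).const_mul _).deriv]
  linear_combination (u r * azPhase m φ * S θ * (m : ℂ) ^ 2) * Complex.I_sq

/-- `∂_r ∂_φ G = im u' e^{imφ} S`. [folklore] -/
theorem deriv_T4 :
    deriv (fun s ↦ deriv (fun p ↦ G s θ p) φ) r =
      deriv u r * ((m : ℂ) * Complex.I * azPhase m φ * S θ) := by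
  have hev : (fun s ↦ deriv (fun p ↦ G s θ p) φ) =ᶠ[𝓝 r]
      fun s ↦ u s * ((m : ℂ) * Complex.I * azPhase m φ * S θ) := by
    filter_upwards [h.hA] with s hs
    have heq : (fun p ↦ G s θ p) =ᶠ[𝓝 φ] fun p ↦ u s * (azPhase m p * S θ) := by
      filter_upwards [h.hC] with p hp using h.eq s hs θ h.θ_mem p hp
    rw [heq.deriv_eq]
    exact (((hasDerivAt_azPhase m φ).mul_const _).const_mul _).deriv
  rw [hev.deriv_eq]
  exact ((h.hu.differentiableAt (by simp)).hasDerivAt.mul_const _).deriv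

/-- `∂_φ ∂_r G = im u' e^{imφ} S`. [folklore] -/
theorem deriv_T5 :
    deriv (fun p ↦ deriv (fun s ↦ G s θ p) r) φ =
      deriv u r * ((m : ℂ) * Complex.I * azPhase m φ * S θ) := by
  have hev : (fun p ↦ deriv (fun s ↦ G s θ p) r) =ᶠ[𝓝 φ]
      fun p ↦ deriv u r * (azPhase m p * S θ) := by
    filter_upwards [h.hC] with p hp
    have heq : (fun s ↦ G s θ p) =ᶠ[𝓝 r] fun s ↦ u s * (azPhase m p * S θ) := by
      filter_upwards [h.hA] with s hs using h.eq s hs θ h.θ_mem p hp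
    rw [heq.deriv_eq]
    exact ((h.hu.differentiableAt (by simp)).hasDerivAt.mul_const _).deriv
  rw [hev.deriv_eq, (((hasDerivAt_azPhase m φ).mul_const _).const_mul _).deriv]

end IsSeparatedNear

end Separated

/-! ### Separation of the reduced equation -/

/-- **The reduced Kerr wave operator on a separated profile.** If near `y = Y_a(r, θ, φ)` (`r > 0`,
`sin θ ≠ 0`) the profile reads `Φ(Y_a(s, t, p)) = u(s) e^{imp} S(t)` with `u`, `S` of class `C²`,
then `Σ P_ω Φ(y) = e^{imφ} (S(θ) · 𝓡u(r) + u(r) · 𝓐S(θ))` with the **ingoing radial operator**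
`𝓡u = Δ u'' + Δ' u' + (2iam − 4iωMr) u' + (ω²(r² + 2Mr) − 2iωM) u` (`Δ = r² − 2Mr + a²`) and the
**angular operator** `𝓐S = (cos θ S' + sin θ S'')/sin θ − m² S/sin² θ + a²ω² cos² θ S`
(SR, CMP 329 (2014), §2: the operators of (2.2) — conjugated to the ingoing chart, see
`ingoingRadial_of_radialODE` — and of (2.1)). [cite: ShlapentokhRothman2014KleinGordon, §2 (2.1)–(2.2)] -/
theorem reducedWaveOp_of_separated {M a : ℝ} (w : ℂ) {Φ : E3 → ℂ} {u S : ℝ → ℂ} {m : ℤ}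
    {A B C : Set ℝ} {r θ φ : ℝ} (hr : 0 < r) (hθ : sin θ ≠ 0)
    (hΦ : ContDiffAt ℝ 2 Φ (kerrStar a r θ φ))
    (h : IsSeparatedNear (fun s t p ↦ Φ (kerrStar a s t p)) u S m A B C r θ φ) :
    ((r ^ 2 + a ^ 2 * cos θ ^ 2 : ℝ) : ℂ) * reducedWaveOp M a w Φ (kerrStar a r θ φ) =
      azPhase m φ *
        (S θ * ((r ^ 2 - 2 * M * r + a ^ 2 : ℂ) * deriv (deriv u) r + (2 * r - 2 * M : ℂ) * deriv u r
            + (2 * Complex.I * a * m - 4 * Complex.I * w * M * r) * deriv u r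
            + (w ^ 2 * (r ^ 2 + 2 * M * r) - 2 * Complex.I * w * M) * u r)
        + u r * ((cos θ * deriv S θ + sin θ * deriv (deriv S) θ) / sin θ
            - (m : ℂ) ^ 2 / (sin θ : ℂ) ^ 2 * S θ + w ^ 2 * a ^ 2 * (cos θ : ℂ) ^ 2 * S θ)) := by
  have hsC : Complex.sin (θ : ℂ) ≠ 0 := by rw [← Complex.ofReal_sin]; exact_mod_cast hθ
  have h0 : Φ (kerrStar a r θ φ) = u r * (azPhase m φ * S θ) := h.eq r h.r_mem θ h.θ_mem φ h.φ_mem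
  have hT1 := h.deriv_T1 a
  have hTr := h.deriv_r
  have hTrr := h.deriv_deriv_r
  have hT2 := h.deriv_T2
  have hT3 := h.deriv_T3
  have hT4 := h.deriv_T4
  have hT5 := h.deriv_T5
  beta_reduce at hT1 hTr hTrr hT2 hT3 hT4 hT5
  rw [reducedWaveOp_kerrStar w hr hθ hΦ, hT1, hTr, hTrr, hT2, hT3, hT4, hT5, h0]
  simp only [Complex.real_smul]
  push_cast at hsC ⊢
  field_simp
  ring

/-- **Separation of the reduced equation.** In the situation of `reducedWaveOp_of_separated`, if
`S` satisfies the angular ODE (2.1) at `θ` (in expanded form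
`(cos θ S' + sin θ S'')/sin θ − (m²/sin² θ − a²(ω² − μ²) cos² θ) S + λ S = 0`) and `u` satisfies the
ingoing radial ODE at `r`, `Δ u'' + Δ' u' + (2iam − 4iωMr) u' + (ω²(r² + 2Mr) − 2iωM − λ − μ²r²) u = 0`
(the conjugate of (2.2), `ingoingRadial_of_radialODE`), then `P_ω Φ(y) = μ² Φ(y)` at
`y = Y_a(r, θ, φ)`: the separated equations recombine to `Σ P_ω Φ = μ² Σ Φ` and `Σ = r² + a² cos² θ > 0`.
SR, CMP 329 (2014), §2. [cite: ShlapentokhRothman2014KleinGordon, §2 (2.1)–(2.2)] -/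
theorem reducedWaveOp_eq_mass_of_separated {M a μ : ℝ} (w lam : ℂ) {Φ : E3 → ℂ} {u S : ℝ → ℂ}
    {m : ℤ} {A B C : Set ℝ} {r θ φ : ℝ} (hr : 0 < r) (hθ : sin θ ≠ 0)
    (hΦ : ContDiffAt ℝ 2 Φ (kerrStar a r θ φ))
    (h : IsSeparatedNear (fun s t p ↦ Φ (kerrStar a s t p)) u S m A B C r θ φ)
    (hang : (cos θ * deriv S θ + sin θ * deriv (deriv S) θ) / sin θ
      - ((m : ℂ) ^ 2 / (sin θ : ℂ) ^ 2 - a ^ 2 * (w ^ 2 - μ ^ 2) * (cos θ : ℂ) ^ 2) * S θ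
      + lam * S θ = 0)
    (hrad : (r ^ 2 - 2 * M * r + a ^ 2 : ℂ) * deriv (deriv u) r + (2 * r - 2 * M : ℂ) * deriv u r
      + (2 * Complex.I * a * m - 4 * Complex.I * w * M * r) * deriv u r
      + (w ^ 2 * (r ^ 2 + 2 * M * r) - 2 * Complex.I * w * M - lam - μ ^ 2 * r ^ 2) * u r = 0) :
    reducedWaveOp M a w Φ (kerrStar a r θ φ) = μ ^ 2 * Φ (kerrStar a r θ φ) := by
  have hSig : (0 : ℝ) < r ^ 2 + a ^ 2 * cos θ ^ 2 := sq_add_sq_mul_cos_sq_pos a hr.ne' θ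
  have hSC : ((r ^ 2 + a ^ 2 * cos θ ^ 2 : ℝ) : ℂ) ≠ 0 := by exact_mod_cast hSig.ne'
  have hsep := reducedWaveOp_of_separated (M := M) w hr hθ hΦ h
  have h0 : Φ (kerrStar a r θ φ) = u r * (azPhase m φ * S θ) := h.eq r h.r_mem θ h.θ_mem φ h.φ_mem
  apply mul_left_cancel₀ hSC
  rw [hsep, h0]
  push_cast at hang hrad ⊢
  linear_combination (azPhase m φ * S θ) * hrad + (azPhase m φ * u r) * hang

/-! ### Mode solutions in the sense of SR §2 (the printed ODEs with their boundary conditions) -/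

/-- **Mode solutions of the Klein–Gordon equation on Kerr, in the sense of Shlapentokh-Rothman
(CMP 329 (2014), §2), with parameters `(ω, m, μ)` and separation constant `λ`.** Printed (§2, *Mode
Solutions*): "we work in Boyer–Lindquist coordinates and consider solutions of the form
`ψ(t, r, θ, φ) := e^{−iωt} e^{imφ} S_{ml}(θ) R(r)` with `ω ∈ ℂ`. In order for `ψ` to satisfy the
Klein–Gordon equation, `S_{ml}` and `R` must satisfy"
(2.1) `(1/sin θ) d/dθ(sin θ dS_{ml}/dθ) − (m²/sin² θ − a²(ω² − μ²) cos² θ) S_{ml} + λ_{ml} S_{ml} = 0`,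
(2.2) `Δ d/dr(Δ dR/dr) − V_μ R = 0`,
`V_μ := −(r² + a²)²ω² + 4Mamrω − a²m² + Δ(λ_{ml} + a²ω² + μ²r²)`, "the angular ODE and the
radial ODE", with the boundary conditions "so that `ψ` extends smoothly to the whole spacetime and
has finite energy": `m ∈ ℤ`; "the condition that `e^{imφ} S_{ml}(θ)` extends to `𝕊²`" (a regular
Sturm–Liouville problem for real `ω`, its eigenvalues embedded "into holomorphic curves
`λ_{ml}(κ)`", `κ = a²(ω² − μ²)`, second appendix); at the horizon, in Kerr-star coordinates
`ψ = e^{−iω(t* − t̄(r))} e^{im(φ* − φ̄(r))} S_{ml}(θ) R(r)` "extends smoothly to `r = r₊`. This will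
happen if we can write (2.3) `R(r) = e^{−i(ω t̄(r) − m φ̄(r))} f(r)` where `f` extends smoothly to
`r₊`" (equivalently (2.4) `R = (r − r₊)^ξ ρ`, `ξ = i(am − 2Mr₊ω)/(r₊ − r₋)`, `ρ` smooth), `t̄`, `φ̄`
being "defined on `(r₊, ∞)` up to a constant by `dt̄/dr := (r² + a²)/Δ`, `dφ̄/dr := a/Δ`" (§1.2.1);
and finite energy, (2.5) `∫_{r₊+1}^∞ (|R|² + |dR/dr|²) r² dr < ∞`, which by the asymptotic analysis
of the radial ODE at infinity makes `R` exponentially decaying (third appendix; §3.1: "all solutions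
are either exponentially growing or exponentially decaying at infinity. Since our mode solution must
have finite energy (2.5), we conclude that `R` is exponentially decaying at infinity").

**Vendored form** (a structure carrying the data of a mode solution on the sub-extremal Kerr
exterior with parameters `M, a, μ, ω, m`): a separation constant `λ ∈ ℂ` (`lam`) and functions
`S, R : ℝ → ℂ` with
* (angular) `S` of class `C²` on `(0, π)` solving (2.1) there (literally
  `deriv (sin · deriv S) θ / sin θ − (m²/sin² θ − a²(ω² − μ²) cos² θ) S θ + λ S θ = 0`), the function
  `e^{imφ} S(θ)` extending to a smooth function on `𝕊²` — rendered by `𝒮 : E3 → ℂ`, `C^∞` on an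
  open set `U` containing the unit sphere, with `𝒮(n̂(θ, φ)) = e^{imφ} S(θ)` for `θ ∈ (0, π)`, `φ ∈ ℝ`
  (`n̂ = sphRadial`, `KerrStarCoord.lean`) — and `S ≢ 0` on `(0, π)`;
* (radial) `R` of class `C²` on `(r₊, ∞)` solving (2.2) there with `V_μ` as printed
  (`Δ = r² − 2Mr + a²`), `R ≢ 0` on `(r₊, ∞)`; (2.3): functions `t̄, φ̄ : ℝ → ℝ` (`tbar`, `phibar`)
  with `dt̄/dr = (r² + a²)/Δ`, `dφ̄/dr = a/Δ` on `(r₊, ∞)` and `f : ℝ → ℂ`, `C^∞` at every point of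
  `[r₊, ∞)`, with `R = e^{−i(ω t̄ − m φ̄)} f` on `(r₊, ∞)`; and (2.5 with the third appendix)
  `‖R(r)‖, ‖R'(r)‖ ≤ C e^{−κr}` for `r ≥ r₊ + 1`, some `C` and `κ > 0`.

Rendering (every deviation from the printed wording): (i) "extends [smoothly] to `𝕊²`" is an
ambient `C^∞` function near the embedded unit sphere of `ℝ³` (every smooth function on the sphere
so extends, e.g. `0`-homogeneously); (ii) "`f` extends smoothly to `r₊`" is `C^∞` at every point of
`[r₊, ∞)`, i.e. on an open set containing the closed half-line (printed: `f` is even real-analytic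
at `r₊`, first appendix and (2.4)); (iii) the `C²` regularity of `S` on `(0, π)` and of `R` on
`(r₊, ∞)`, implicit in "satisfy (2.1), (2.2)" (solutions of these linear ODEs with analytic
coefficients are analytic), is stated, and so is non-triviality `S ≢ 0`, `R ≢ 0` (a mode solution is
a non-zero solution); (iv) finite energy (2.5) is carried through its printed consequence, the
exponential decay of `R` and `dR/dr` on `[r₊ + 1, ∞)` (as at `ShlapentokhRothman2014_unstableModeProfile`);
(v) `t̄`, `φ̄` are any primitives, as printed ("up to a constant"); (vi) the index `l` and the
indexing of `λ_{ml}` are not carried. In these terms Shlapentokh-Rothman's Theorem 1.2 (with the mass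
clause of Thm. 1.1) asserts, for `0 < |a| < M`, `m ≠ 0`, `δ > 0`, the existence of `μ > 0` with
`|μ − |am|/(2Mr₊)| < δ` and `ω` with `Im ω > 0`, `Re ω ≠ 0`, `2Mr₊|ω| < |am|` such that
`ModeSolution M a μ ω m` is non-empty — the hypothesis of
`ShlapentokhRothman2014_unstableModeProfile.of_modeSolutions` below, which PROVES the profile form
from it; that hypothesis (SR's ODE analysis: angular eigenvalue curves, local theory at `r₊` and at
infinity, variational real modes, implicit-function perturbation into `Im ω > 0`) is deliberately
not vendored as a named fact in this proving unit (D-0026).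
[cite: ShlapentokhRothman2014KleinGordon, §2 (2.1)–(2.5) with §1.2.1 and the appendix "Local theory for the radial ODE"] -/
structure ModeSolution (M a μ : ℝ) (w : ℂ) (m : ℤ) where
  /-- the separation constant `λ_{ml}` -/
  lam : ℂ
  /-- the angular function `S_{ml}` -/
  S : ℝ → ℂ
  /-- the radial function `R` -/
  R : ℝ → ℂ
  /-- `S` is `C²` on `(0, π)` -/
  contDiffOn_S : ContDiffOn ℝ 2 S (Ioo 0 π)
  /-- the angular ODE (2.1) on `(0, π)` -/
  angularODE : ∀ θ ∈ Ioo 0 π,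
    deriv (fun t ↦ (Real.sin t : ℂ) * deriv S t) θ / Real.sin θ
      - ((m : ℂ) ^ 2 / (Real.sin θ : ℂ) ^ 2 - a ^ 2 * (w ^ 2 - μ ^ 2) * (Real.cos θ : ℂ) ^ 2) * S θ
      + lam * S θ = 0
  /-- the smooth extension of `e^{imφ} S(θ)` to (a neighbourhood of) the unit sphere -/
  𝒮 : E3 → ℂ
  /-- the open neighbourhood of the unit sphere on which `𝒮` is smooth -/
  U : Set E3
  /-- `U` is open -/
  isOpen_U : IsOpen U
  /-- `U` contains the unit sphere -/
  sphere_subset_U : sphere (0 : E3) 1 ⊆ U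
  /-- `𝒮` is `C^∞` on `U` -/
  contDiffOn_𝒮 : ContDiffOn ℝ ∞ 𝒮 U
  /-- `𝒮(n̂(θ, φ)) = e^{imφ} S(θ)` -/
  𝒮_sphRadial : ∀ θ ∈ Ioo 0 π, ∀ φ : ℝ,
    𝒮 (sphRadial θ φ) = Complex.exp ((m : ℂ) * (φ : ℂ) * Complex.I) * S θ
  /-- `S ≢ 0` -/
  S_ne_zero : ∃ θ ∈ Ioo 0 π, S θ ≠ 0
  /-- `R` is `C²` on `(r₊, ∞)` -/
  contDiffOn_R : ContDiffOn ℝ 2 R (Ioi (Kerr.rPlus M a))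
  /-- the radial ODE (2.2) on `(r₊, ∞)` -/
  radialODE : ∀ r ∈ Ioi (Kerr.rPlus M a),
    ((r ^ 2 - 2 * M * r + a ^ 2 : ℝ) : ℂ) *
        deriv (fun s : ℝ ↦ ((s ^ 2 - 2 * M * s + a ^ 2 : ℝ) : ℂ) * deriv R s) r
      - (-(r ^ 2 + a ^ 2) ^ 2 * w ^ 2 + 4 * M * a * m * r * w - a ^ 2 * m ^ 2
          + (r ^ 2 - 2 * M * r + a ^ 2) * (lam + a ^ 2 * w ^ 2 + μ ^ 2 * r ^ 2) : ℂ) * R r = 0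
  /-- `R ≢ 0` -/
  R_ne_zero : ∃ r ∈ Ioi (Kerr.rPlus M a), R r ≠ 0
  /-- the Kerr-star time shift `t̄` -/
  tbar : ℝ → ℝ
  /-- the Kerr-star angle shift `φ̄` -/
  phibar : ℝ → ℝ
  /-- the horizon-regular radial factor `f` of (2.3) -/
  f : ℝ → ℂ
  /-- `dt̄/dr = (r² + a²)/Δ`, `dφ̄/dr = a/Δ` on `(r₊, ∞)` (§1.2.1) -/
  hasDerivAt_tbar_phibar : ∀ r ∈ Ioi (Kerr.rPlus M a),
    HasDerivAt tbar ((r ^ 2 + a ^ 2) / (r ^ 2 - 2 * M * r + a ^ 2)) r ∧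
    HasDerivAt phibar (a / (r ^ 2 - 2 * M * r + a ^ 2)) r
  /-- `f` extends smoothly to `r₊` -/
  contDiffAt_f : ∀ r, Kerr.rPlus M a ≤ r → ContDiffAt ℝ ∞ f r
  /-- (2.3) `R = e^{−i(ωt̄ − mφ̄)} f` on `(r₊, ∞)` -/
  R_eq : ∀ r ∈ Ioi (Kerr.rPlus M a),
    R r = Complex.exp (-Complex.I * (w * tbar r - m * phibar r)) * f r
  /-- the decay constant -/
  C : ℝ
  /-- the decay rate -/
  κ : ℝ
  /-- `κ > 0` -/
  κ_pos : 0 < κ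
  /-- finite energy ⟹ exponential decay of `R`, `R'` on `[r₊ + 1, ∞)` -/
  decay : ∀ r, Kerr.rPlus M a + 1 ≤ r →
    ‖R r‖ ≤ C * Real.exp (-(κ * r)) ∧ ‖deriv R r‖ ≤ C * Real.exp (-(κ * r))

/-! ### The Kerr–Schild profile of a separated mode -/

/-- `‖ℓ⃗‖ = 1` wherever `r > 0`: the Kerr–Schild null vector `ℓ♯ = (−1, ℓ⃗)` is `η`-null.
[cite: arXiv07060622, (34)–(35)] -/
theorem norm_nullSpatial {a : ℝ} {x : E4} (hx : 0 < Kerr.radius a x) : ‖Kerr.nullSpatial a x‖ = 1 := by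
  have h := Kerr.sum_nullVector_mul_nullCovectorFun hx
  rw [Fin.sum_univ_four, Kerr.nullVector_apply_zero, Kerr.nullCovectorFun_apply_zero,
    Kerr.nullVector_apply_one, Kerr.nullVector_apply_two, Kerr.nullVector_apply_three] at h
  have hsq : ‖Kerr.nullSpatial a x‖ ^ 2 = 1 := by
    rw [E3.norm_sq, Kerr.nullSpatial_apply, Kerr.nullSpatial_apply, Kerr.nullSpatial_apply]
    simp only [Fin.succ_zero_eq_one, Fin.succ_one_eq_two]
    rw [show (2 : Fin 3).succ = 3 from rfl]
    nlinarith [h]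
  have h0 : 0 ≤ ‖Kerr.nullSpatial a x‖ := norm_nonneg _
  nlinarith [hsq, h0]

/-- The spatial null vector on the leaf lies on the unit sphere (`r > 0`). [cite: arXiv07060622, (34)–(35)] -/
theorem nullSpatial_mem_sphere {a : ℝ} {y : E3} (hr : 0 < Kerr.radius a (E4.ofTimeSpace 0 y)) :
    Kerr.nullSpatial a (E4.ofTimeSpace 0 y) ∈ sphere (0 : E3) 1 := by
  rw [mem_sphere_zero_iff_norm]
  exact norm_nullSpatial hr

/-- `y ↦ ℓ⃗(0, y)` is smooth on `{r > 0}`. [cite: KerrSchild1965, §2] -/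
theorem contDiffAt_nullSpatial_leaf {a : ℝ} {y : E3} (hr : 0 < Kerr.radius a (E4.ofTimeSpace 0 y))
    {n : WithTop ℕ∞} : ContDiffAt ℝ n (fun y : E3 ↦ Kerr.nullSpatial a (E4.ofTimeSpace 0 y)) y := by
  have h1 : ContDiffAt ℝ n (fun y : E3 ↦ Kerr.nullVector a (E4.ofTimeSpace 0 y)) y :=
    (Kerr.contDiffAt_nullVector a hr).comp y (E4.contDiff_ofTimeSpace 0).contDiffAt
  exact E4.spatial.contDiff.contDiffAt.comp y h1

/-- The **Kerr–Schild profile of a separated mode**: for a radial factor `f` (the horizon-regular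
factor of SR (2.3)), a frequency `ω` and an angular factor `𝒮` (a function near `𝕊² ⊆ ℝ³` with
`𝒮(n̂(θ, φ)) = e^{imφ} S_{ml}(θ)`), the function
`Φ(y) = e^{−iω r(y)} f(r(y)) · 𝒮(ℓ⃗(y))` on the leaf, `r(y) = r(0, y)` the Kerr–Schild radius and
`ℓ⃗(y)` the spatial null vector (= `n̂(θ, φ_KS)` of the Kerr-star angles of `y`,
`Kerr.nullSpatial_kerrStar`). In Kerr's ingoing spheroidal coordinates,
`Φ(Y_a(r, θ, φ)) = e^{−iωr} f(r) e^{imφ} S_{ml}(θ)` (`modeProfile_kerrStar`), i.e. `e^{−iωt_KS} Φ` is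
the printed mode `e^{−iωt} e^{imφ_BL} S_{ml}(θ) R(r)` of SR §2 written in the ingoing Kerr–Schild
chart (`t = t_KS + r − t̄(r)`, `φ_BL = φ_KS − φ̄(r)`, `R = e^{−i(ωt̄ − mφ̄)} f`).
[cite: ShlapentokhRothman2014KleinGordon, §2 (mode solutions, (2.3))] -/
def modeProfile (a : ℝ) (w : ℂ) (f : ℝ → ℂ) (𝒮 : E3 → ℂ) (y : E3) : ℂ :=
  Complex.exp (-Complex.I * w * (Kerr.radius a (E4.ofTimeSpace 0 y) : ℂ)) *
    f (Kerr.radius a (E4.ofTimeSpace 0 y)) * 𝒮 (Kerr.nullSpatial a (E4.ofTimeSpace 0 y))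

/-- The profile in Kerr's ingoing spheroidal coordinates: `Φ(Y_a(s, θ, φ)) = e^{−iωs} f(s) 𝒮(n̂(θ, φ))`
for `s > 0`. [cite: ShlapentokhRothman2014KleinGordon, §2] -/
theorem modeProfile_kerrStar (a : ℝ) (w : ℂ) (f : ℝ → ℂ) (𝒮 : E3 → ℂ) {s : ℝ} (hs : 0 < s)
    (θ φ : ℝ) :
    modeProfile a w f 𝒮 (kerrStar a s θ φ) =
      Complex.exp (-Complex.I * w * (s : ℂ)) * f s * 𝒮 (sphRadial θ φ) := by
  rw [modeProfile, radius_kerrStar a hs, nullSpatial_kerrStar a hs]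

/-- **Smoothness of the profile on the exterior slice**: if `f` is `C^∞` at every `r ≥ r₊` and `𝒮`
is `C^∞` on an open set containing the unit sphere, then `Φ` is `C^∞` on `Kerr.slice a r₊`
(there `r(y) > max(r₊, 0)`, the radius and `ℓ⃗` are smooth, and `ℓ⃗(y) ∈ 𝕊²`). [folklore] -/
theorem contDiffOn_modeProfile {a r₀ : ℝ} (w : ℂ) {f : ℝ → ℂ} {𝒮 : E3 → ℂ} {U : Set E3}
    (hf : ∀ r, r₀ ≤ r → ContDiffAt ℝ ∞ f r) (hU : IsOpen U) (hsub : sphere (0 : E3) 1 ⊆ U)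
    (h𝒮 : ContDiffOn ℝ ∞ 𝒮 U) :
    ContDiffOn ℝ ∞ (modeProfile a w f 𝒮) (Kerr.slice a r₀) := by
  intro y hy
  have hr : 0 < Kerr.radius a (E4.ofTimeSpace 0 y) := Kerr.radius_pos_of_mem_region hy
  have hr₀ : r₀ ≤ Kerr.radius a (E4.ofTimeSpace 0 y) :=
    ((le_max_left r₀ 0).trans_lt (Kerr.mem_slice.1 hy)).le
  have hrad : ContDiffAt ℝ ∞ (fun y : E3 ↦ Kerr.radius a (E4.ofTimeSpace 0 y)) y :=
    Kerr.contDiffAt_radius_slice hr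
  have hexp : ContDiffAt ℝ ∞
      (fun y : E3 ↦ Complex.exp (-Complex.I * w * (Kerr.radius a (E4.ofTimeSpace 0 y) : ℂ))) y := by
    have h1 : ContDiffAt ℝ ∞ (fun y : E3 ↦ (Kerr.radius a (E4.ofTimeSpace 0 y) : ℂ)) y :=
      Complex.ofRealCLM.contDiff.contDiffAt.comp y hrad
    exact Complex.contDiff_exp.contDiffAt.comp y (contDiffAt_const.mul h1)
  have hfy : ContDiffAt ℝ ∞ (fun y : E3 ↦ f (Kerr.radius a (E4.ofTimeSpace 0 y))) y :=
    (hf _ hr₀).comp y hrad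
  have hℓ : ContDiffAt ℝ ∞ (fun y : E3 ↦ 𝒮 (Kerr.nullSpatial a (E4.ofTimeSpace 0 y))) y :=
    (h𝒮.contDiffAt (hU.mem_nhds (hsub (nullSpatial_mem_sphere hr)))).comp y
      (contDiffAt_nullSpatial_leaf hr)
  exact ((hexp.mul hfy).mul hℓ).contDiffWithinAt

/-- **The profile is separated in Kerr's ingoing spheroidal coordinates**: near any `(r, θ, φ)` with
`r > 0`, `θ ∈ (0, π)`, and with `𝒮(n̂(θ, φ)) = e^{imφ} S(θ)` on `(0, π)`,
`Φ(Y_a(s, t, p)) = u(s) e^{imp} S(t)` with `u(s) = e^{−iωs} f(s)` (`IsSeparatedNear` on the box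
`(0, ∞) × (0, π) × ℝ`). [cite: ShlapentokhRothman2014KleinGordon, §2] -/
theorem isSeparatedNear_modeProfile {a : ℝ} (w : ℂ) {f : ℝ → ℂ} {𝒮 : E3 → ℂ} {S : ℝ → ℂ} {m : ℤ}
    (h𝒮S : ∀ θ ∈ Ioo 0 π, ∀ φ : ℝ, 𝒮 (sphRadial θ φ) = Complex.exp ((m : ℂ) * (φ : ℂ) * Complex.I) * S θ)
    {r θ φ : ℝ} (hr : 0 < r) (hθ : θ ∈ Ioo 0 π)
    (hu : ContDiffAt ℝ 2 (fun s : ℝ ↦ Complex.exp (-Complex.I * w * (s : ℂ)) * f s) r)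
    (hS : ContDiffAt ℝ 2 S θ) :
    IsSeparatedNear (fun s t p ↦ modeProfile a w f 𝒮 (kerrStar a s t p))
      (fun s : ℝ ↦ Complex.exp (-Complex.I * w * (s : ℂ)) * f s) S m (Ioi 0) (Ioo 0 π) univ r θ φ where
  hA := Ioi_mem_nhds hr
  hB := Ioo_mem_nhds hθ.1 hθ.2
  hC := univ_mem
  eq := by
    intro s hs t ht p _
    rw [modeProfile_kerrStar a w f 𝒮 hs, h𝒮S t ht p, azPhase, mul_assoc]
  hu := hu
  hS := hS

/-- The profile does not vanish identically: at `y = Y_a(r₀, θ₀, 0)` with `f(r₀) ≠ 0`,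
`S(θ₀) ≠ 0` (`r₀ > 0`, `θ₀ ∈ (0, π)`), `Φ(y) = e^{−iωr₀} f(r₀) S(θ₀) ≠ 0`. [folklore] -/
theorem modeProfile_ne_zero {a : ℝ} (w : ℂ) {f : ℝ → ℂ} {𝒮 : E3 → ℂ} {S : ℝ → ℂ} {m : ℤ}
    (h𝒮S : ∀ θ ∈ Ioo 0 π, ∀ φ : ℝ, 𝒮 (sphRadial θ φ) = Complex.exp ((m : ℂ) * (φ : ℂ) * Complex.I) * S θ)
    {r₀ θ₀ : ℝ} (hr₀ : 0 < r₀) (hθ₀ : θ₀ ∈ Ioo 0 π) (hS : S θ₀ ≠ 0) (hf : f r₀ ≠ 0) :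
    modeProfile a w f 𝒮 (kerrStar a r₀ θ₀ 0) ≠ 0 := by
  rw [modeProfile_kerrStar a w f 𝒮 hr₀, h𝒮S θ₀ hθ₀ 0]
  simp [Complex.exp_ne_zero, hS, hf]

/-- **The profile solves the reduced equation on the exterior slice.** Under the clauses of
`ModeSolution` (angular ODE (2.1) with the smooth extension of `e^{imφ}S` to
`𝕊²`, radial ODE (2.2) on `(r₊, ∞)` with the horizon form (2.3)), the Kerr–Schild profile
`Φ = modeProfile a ω f 𝒮` satisfies `P_ω Φ = μ² Φ` at every point of `Kerr.slice a r₊`: off the axis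
by separation in Kerr's ingoing spheroidal coordinates (`reducedWaveOp_eq_mass_of_separated`,
`ingoingRadial_of_radialODE`), on the axis by continuity (`Kerr.eqOn_slice_of_offAxis`).
SR, CMP 329 (2014), §2. [cite: ShlapentokhRothman2014KleinGordon, §2 (2.1)–(2.3)] -/
theorem reducedWaveOp_modeProfile {M a μ : ℝ} (hMa : Kerr.IsSubextremal M a) {w lam : ℂ} {m : ℤ}
    {S R f : ℝ → ℂ} {𝒮 : E3 → ℂ} {U : Set E3} {tbar phibar : ℝ → ℝ}
    (hS2 : ContDiffOn ℝ 2 S (Ioo 0 π))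
    (hSode : ∀ θ ∈ Ioo 0 π,
      deriv (fun t ↦ (Real.sin t : ℂ) * deriv S t) θ / Real.sin θ
        - ((m : ℂ) ^ 2 / (Real.sin θ : ℂ) ^ 2 - a ^ 2 * (w ^ 2 - μ ^ 2) * (Real.cos θ : ℂ) ^ 2) * S θ
        + lam * S θ = 0)
    (hU : IsOpen U) (hsub : sphere (0 : E3) 1 ⊆ U) (h𝒮 : ContDiffOn ℝ ∞ 𝒮 U)
    (h𝒮S : ∀ θ ∈ Ioo 0 π, ∀ φ : ℝ, 𝒮 (sphRadial θ φ) = Complex.exp ((m : ℂ) * (φ : ℂ) * Complex.I) * S θ)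
    (hR2 : ContDiffOn ℝ 2 R (Ioi (Kerr.rPlus M a)))
    (hRode : ∀ r ∈ Ioi (Kerr.rPlus M a),
      ((r ^ 2 - 2 * M * r + a ^ 2 : ℝ) : ℂ) *
          deriv (fun s : ℝ ↦ ((s ^ 2 - 2 * M * s + a ^ 2 : ℝ) : ℂ) * deriv R s) r
        - (-(r ^ 2 + a ^ 2) ^ 2 * w ^ 2 + 4 * M * a * m * r * w - a ^ 2 * m ^ 2
            + (r ^ 2 - 2 * M * r + a ^ 2) * (lam + a ^ 2 * w ^ 2 + μ ^ 2 * r ^ 2) : ℂ) * R r = 0)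
    (htp : ∀ r ∈ Ioi (Kerr.rPlus M a),
      HasDerivAt tbar ((r ^ 2 + a ^ 2) / (r ^ 2 - 2 * M * r + a ^ 2)) r ∧
      HasDerivAt phibar (a / (r ^ 2 - 2 * M * r + a ^ 2)) r)
    (hf : ∀ r, Kerr.rPlus M a ≤ r → ContDiffAt ℝ ∞ f r)
    (hRf : ∀ r ∈ Ioi (Kerr.rPlus M a),
      R r = Complex.exp (-Complex.I * (w * tbar r - m * phibar r)) * f r) :
    ∀ y ∈ Kerr.slice a (Kerr.rPlus M a),
      reducedWaveOp M a w (modeProfile a w f 𝒮) y = μ ^ 2 * modeProfile a w f 𝒮 y := by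
  have hΦ : ContDiffOn ℝ ∞ (modeProfile a w f 𝒮) (Kerr.slice a (Kerr.rPlus M a)) :=
    contDiffOn_modeProfile w hf hU hsub h𝒮
  have hS' : IsOpen (Kerr.slice a (Kerr.rPlus M a) : Set E3) := (Kerr.slice a _).isOpen
  have hexp2 : ∀ r : ℝ, ContDiffAt ℝ 2 (fun s : ℝ ↦ Complex.exp (-Complex.I * w * (s : ℂ))) r :=
    fun r ↦ (Complex.contDiff_exp.comp (contDiff_const.mul Complex.ofRealCLM.contDiff)).contDiffAt
  -- off the axis: separation of variables
  have hoff : ∀ y ∈ Kerr.slice a (Kerr.rPlus M a), (y 0 ≠ 0 ∨ y 1 ≠ 0) →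
      reducedWaveOp M a w (modeProfile a w f 𝒮) y = μ ^ 2 * modeProfile a w f 𝒮 y := by
    intro y hy hax
    have hr : 0 < Kerr.radius a (E4.ofTimeSpace 0 y) := Kerr.radius_pos_of_mem_region hy
    have hrp : Kerr.rPlus M a < Kerr.radius a (E4.ofTimeSpace 0 y) :=
      (le_max_left _ 0).trans_lt (Kerr.mem_slice.1 hy)
    obtain ⟨θ, hθ, φ, hyeq⟩ := exists_kerrStar_eq hr hax
    set r := Kerr.radius a (E4.ofTimeSpace 0 y) with hr_def
    have hyS : kerrStar a r θ φ ∈ Kerr.slice a (Kerr.rPlus M a) := by rw [hyeq]; exact hy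
    rw [← hyeq]
    have hΦy : ContDiffAt ℝ 2 (modeProfile a w f 𝒮) (kerrStar a r θ φ) :=
      (hΦ.contDiffAt (hS'.mem_nhds hyS)).of_le (WithTop.coe_le_coe.2 le_top)
    have hsin : Real.sin θ ≠ 0 := (Real.sin_pos_of_pos_of_lt_pi hθ.1 hθ.2).ne'
    have hu2 : ContDiffAt ℝ 2 (fun s : ℝ ↦ Complex.exp (-Complex.I * w * (s : ℂ)) * f s) r :=
      (hexp2 r).mul ((hf r hrp.le).of_le (WithTop.coe_le_coe.2 le_top))
    have hSθ : ContDiffAt ℝ 2 S θ := hS2.contDiffAt (Ioo_mem_nhds hθ.1 hθ.2)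
    have hsep := isSeparatedNear_modeProfile (a := a) (φ := φ) w h𝒮S hr hθ hu2 hSθ
    refine reducedWaveOp_eq_mass_of_separated w lam hr hsin hΦy hsep ?_ ?_
    · -- the angular ODE, expanded
      have h := hSode θ hθ
      rwa [deriv_sin_mul_deriv (differentiableAt_deriv_of_contDiffAt hSθ)] at h
    · -- the ingoing radial ODE for `u = e^{−iωs} f`
      have hI : Ioi (Kerr.rPlus M a) ∈ 𝓝 r := Ioi_mem_nhds hrp
      have hΔ : ∀ᶠ s in 𝓝 r, s ^ 2 - 2 * M * s + a ^ 2 ≠ 0 := by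
        filter_upwards [hI] with s hs
        rw [← Kerr.sub_rPlus_mul_sub_rMinus hMa.sq_lt_sq.le]
        exact (Kerr.sub_rPlus_mul_sub_rMinus_pos hs).ne'
      have ht : ∀ᶠ s in 𝓝 r,
          HasDerivAt tbar ((s ^ 2 + a ^ 2) / (s ^ 2 - 2 * M * s + a ^ 2)) s := by
        filter_upwards [hI] with s hs using (htp s hs).1
      have hp : ∀ᶠ s in 𝓝 r, HasDerivAt phibar (a / (s ^ 2 - 2 * M * s + a ^ 2)) s := by
        filter_upwards [hI] with s hs using (htp s hs).2
      have hRd : ∀ᶠ s in 𝓝 r, DifferentiableAt ℝ R s := by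
        filter_upwards [hI] with s hs
        exact (hR2.contDiffAt (Ioi_mem_nhds hs)).differentiableAt (by simp)
      have hR2' : DifferentiableAt ℝ (deriv R) r :=
        differentiableAt_deriv_of_contDiffAt (hR2.contDiffAt hI)
      have hf' : ∀ᶠ s in 𝓝 r, R s = Complex.exp (-Complex.I * (w * tbar s - m * phibar s)) * f s := by
        filter_upwards [hI] with s hs using hRf s hs
      have hfC : ContDiffAt ℝ 2 f r := (hf r hrp.le).of_le (WithTop.coe_le_coe.2 le_top)
      exact ingoingRadial_of_radialODE hΔ ht hp hRd hR2' hf' hfC (hRode r hrp)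
  -- on the axis: by continuity
  have hcont : ContinuousOn (fun y ↦ reducedWaveOp M a w (modeProfile a w f 𝒮) y -
      μ ^ 2 * modeProfile a w f 𝒮 y) (Kerr.slice a (Kerr.rPlus M a)) :=
    (continuousOn_reducedWaveOp w hΦ).sub (continuousOn_const.mul hΦ.continuousOn)
  intro y hy
  have h := Kerr.eqOn_slice_of_offAxis (c := (0 : ℂ)) hcont
    (fun y hy hax ↦ sub_eq_zero.2 (hoff y hy hax)) y hy
  exact sub_eq_zero.1 h

/-! ### Exponential decay of the profile and of its differential on the exterior slice -/

/-- **Bound-state decay of the profile and of its differential.** Under the radial clauses of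
`ModeSolution` and `Im ω > 0`, and with `𝒮` smooth near the unit sphere, the
profile `Φ = modeProfile a ω f 𝒮` satisfies `‖Φ(y)‖ ≤ C' e^{−κ‖y‖}` and `‖DΦ(y)‖ ≤ C' e^{−κ‖y‖}` on
`Kerr.slice a r₊`: `Φ = u(r)·𝒮(ℓ⃗)` with `|u|, |u'| ≤ C₁ e^{−κr}` (`ingoing_bounds`), `𝒮`, `D𝒮` bounded
on `𝕊²`, `|∇r| ≤ 1 + |a|/r₊`, `‖Dℓ⃗‖ ≤ B` (`exists_bound_fderiv_nullSpatial`) and `‖y‖ ≤ r + |a|`.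
SR, CMP 329 (2014), §2 (finite energy, exponential decay at infinity) and §1.2.1.
[cite: ShlapentokhRothman2014KleinGordon, §2 (2.3)–(2.5)] -/
theorem modeProfile_decay {M a : ℝ} (hMa : Kerr.IsSubextremal M a) {w : ℂ} (hw : 0 < w.im) {m : ℤ}
    {R f : ℝ → ℂ} {tbar phibar : ℝ → ℝ} {C κ : ℝ} (hκ : 0 < κ)
    (htp : ∀ r ∈ Ioi (Kerr.rPlus M a),
      HasDerivAt tbar ((r ^ 2 + a ^ 2) / (r ^ 2 - 2 * M * r + a ^ 2)) r ∧
      HasDerivAt phibar (a / (r ^ 2 - 2 * M * r + a ^ 2)) r)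
    (hf : ∀ r, Kerr.rPlus M a ≤ r → ContDiffAt ℝ ∞ f r)
    (hRf : ∀ r ∈ Ioi (Kerr.rPlus M a),
      R r = Complex.exp (-Complex.I * (w * tbar r - m * phibar r)) * f r)
    (hR2 : ContDiffOn ℝ 2 R (Ioi (Kerr.rPlus M a)))
    (hdec : ∀ r, Kerr.rPlus M a + 1 ≤ r →
      ‖R r‖ ≤ C * Real.exp (-(κ * r)) ∧ ‖deriv R r‖ ≤ C * Real.exp (-(κ * r)))
    {𝒮 : E3 → ℂ} {U : Set E3} (hU : IsOpen U) (hsub : sphere (0 : E3) 1 ⊆ U)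
    (h𝒮 : ContDiffOn ℝ ∞ 𝒮 U) :
    ∃ C' : ℝ, ∀ y ∈ Kerr.slice a (Kerr.rPlus M a),
      ‖modeProfile a w f 𝒮 y‖ ≤ C' * Real.exp (-(κ * ‖y‖)) ∧
      ‖fderiv ℝ (modeProfile a w f 𝒮) y‖ ≤ C' * Real.exp (-(κ * ‖y‖)) := by
  set rp := Kerr.rPlus M a with hrp_def
  have hrp : 0 < rp := hMa.rPlus_pos
  obtain ⟨C₁, hC₁⟩ := ingoing_bounds hMa hw (m := m) hκ htp hf hRf hR2 hdec
  obtain ⟨A, hA0, hA⟩ := sphere_bounds hU hsub h𝒮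
  obtain ⟨Bℓ, hBℓ⟩ := exists_bound_fderiv_nullSpatial a hrp
  set q : ℝ := 1 + |a| / rp with hq_def
  have hq0 : 0 ≤ q := by positivity
  set C₁' : ℝ := max C₁ 0 with hC₁'_def
  have hC₁'0 : 0 ≤ C₁' := le_max_right _ _
  set Bℓ' : ℝ := max Bℓ 0 with hBℓ'_def
  have hBℓ'0 : 0 ≤ Bℓ' := le_max_right _ _
  set D : ℝ := C₁' * A * (1 + q + Bℓ') * Real.exp (κ * |a|) with hD_def
  refine ⟨D, fun y hy ↦ ?_⟩
  -- the point
  have hr : 0 < Kerr.radius a (E4.ofTimeSpace 0 y) := Kerr.radius_pos_of_mem_region hy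
  have hrp' : rp < Kerr.radius a (E4.ofTimeSpace 0 y) := (le_max_left _ 0).trans_lt (Kerr.mem_slice.1 hy)
  set r := Kerr.radius a (E4.ofTimeSpace 0 y) with hr_def
  set u : ℝ → ℂ := fun s : ℝ ↦ Complex.exp (-Complex.I * w * (s : ℂ)) * f s with hu_def
  set ℓ : E3 := Kerr.nullSpatial a (E4.ofTimeSpace 0 y) with hℓ_def
  have hℓmem : ℓ ∈ sphere (0 : E3) 1 := nullSpatial_mem_sphere hr
  obtain ⟨h𝒮ℓ, hD𝒮ℓ⟩ := hA ℓ hℓmem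
  obtain ⟨hu0, hu1⟩ := hC₁ r hrp'
  have hexp0 : 0 < Real.exp (-(κ * r)) := Real.exp_pos _
  have hu0' : ‖u r‖ ≤ C₁' * Real.exp (-(κ * r)) :=
    hu0.trans (mul_le_mul_of_nonneg_right (le_max_left _ _) hexp0.le)
  have hu1' : ‖deriv u r‖ ≤ C₁' * Real.exp (-(κ * r)) :=
    hu1.trans (mul_le_mul_of_nonneg_right (le_max_left _ _) hexp0.le)
  have hexp : Real.exp (-(κ * r)) ≤ Real.exp (κ * |a|) * Real.exp (-(κ * ‖y‖)) :=
    exp_neg_mul_radius_le hκ.le hr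
  -- the main estimate: `C₁' e^{−κr} A X ≤ D e^{−κ‖y‖}` for `X ≤ 1 + q + Bℓ'`
  have hmain : ∀ X : ℝ, 0 ≤ X → X ≤ 1 + q + Bℓ' →
      C₁' * Real.exp (-(κ * r)) * A * X ≤ D * Real.exp (-(κ * ‖y‖)) := by
    intro X hX0 hX
    calc C₁' * Real.exp (-(κ * r)) * A * X
        ≤ C₁' * (Real.exp (κ * |a|) * Real.exp (-(κ * ‖y‖))) * A * (1 + q + Bℓ') := by
          gcongr
      _ = D * Real.exp (-(κ * ‖y‖)) := by rw [hD_def]; ring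
  -- (i) the value
  have hval : ‖modeProfile a w f 𝒮 y‖ ≤ D * Real.exp (-(κ * ‖y‖)) := by
    have h1 : ‖modeProfile a w f 𝒮 y‖ = ‖u r‖ * ‖𝒮 ℓ‖ := by
      rw [modeProfile, norm_mul]
    rw [h1]
    calc ‖u r‖ * ‖𝒮 ℓ‖ ≤ C₁' * Real.exp (-(κ * r)) * A :=
          mul_le_mul hu0' h𝒮ℓ (norm_nonneg _) (by positivity)
      _ = C₁' * Real.exp (-(κ * r)) * A * 1 := by ring
      _ ≤ D * Real.exp (-(κ * ‖y‖)) := hmain 1 zero_le_one (by linarith)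
  -- (ii) the differential
  have hrad : HasFDerivAt (fun y : E3 ↦ Kerr.radius a (E4.ofTimeSpace 0 y)) (Kerr.radiusGrad a y) y :=
    Kerr.hasFDerivAt_radius_slice hr
  have hdr : ‖Kerr.radiusGrad a y‖ ≤ q := by
    refine (norm_radiusGrad_le hr).trans ?_
    rw [hq_def]
    gcongr
  obtain ⟨Lℓ, hLℓ, hLℓn⟩ := hBℓ y hrp'.le
  have hLℓn' : ‖Lℓ‖ ≤ Bℓ' := hLℓn.trans (le_max_left _ _)
  have hud : DifferentiableAt ℝ u r := by
    have h1 : ContDiff ℝ ∞ (fun s : ℝ ↦ Complex.exp (-Complex.I * w * (s : ℂ))) :=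
      Complex.contDiff_exp.comp (contDiff_const.mul Complex.ofRealCLM.contDiff)
    exact (h1.contDiffAt.mul (hf r hrp'.le)).differentiableAt (by simp)
  have hcu : HasFDerivAt (u ∘ fun y : E3 ↦ Kerr.radius a (E4.ofTimeSpace 0 y))
      ((ContinuousLinearMap.toSpanSingleton ℝ (deriv u r)).comp (Kerr.radiusGrad a y)) y :=
    hud.hasDerivAt.hasFDerivAt.comp y hrad
  have h𝒮d : DifferentiableAt ℝ 𝒮 ℓ :=
    (h𝒮.contDiffAt (hU.mem_nhds (hsub hℓmem))).differentiableAt (by simp)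
  have hcd : HasFDerivAt (fun y : E3 ↦ 𝒮 (Kerr.nullSpatial a (E4.ofTimeSpace 0 y)))
      ((fderiv ℝ 𝒮 ℓ).comp Lℓ) y := h𝒮d.hasFDerivAt.comp y hLℓ
  have hΦd : HasFDerivAt (modeProfile a w f 𝒮)
      (u r • (fderiv ℝ 𝒮 ℓ).comp Lℓ +
        𝒮 ℓ • (ContinuousLinearMap.toSpanSingleton ℝ (deriv u r)).comp (Kerr.radiusGrad a y)) y := by
    have h := hcu.mul hcd
    exact h
  have hder : ‖fderiv ℝ (modeProfile a w f 𝒮) y‖ ≤ D * Real.exp (-(κ * ‖y‖)) := by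
    rw [hΦd.fderiv]
    refine (norm_add_le _ _).trans ?_
    have h1 : ‖u r • (fderiv ℝ 𝒮 ℓ).comp Lℓ‖ ≤ C₁' * Real.exp (-(κ * r)) * A * Bℓ' := by
      rw [norm_smul]
      refine mul_le_mul hu0' ((ContinuousLinearMap.opNorm_comp_le _ _).trans
        (mul_le_mul hD𝒮ℓ hLℓn' (norm_nonneg _) hA0)) (norm_nonneg _) (by positivity) |>.trans ?_
      exact le_of_eq (by ring)
    have h2 : ‖𝒮 ℓ • (ContinuousLinearMap.toSpanSingleton ℝ (deriv u r)).comp (Kerr.radiusGrad a y)‖ ≤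
        C₁' * Real.exp (-(κ * r)) * A * q := by
      rw [norm_smul]
      have h3 : ‖(ContinuousLinearMap.toSpanSingleton ℝ (deriv u r)).comp (Kerr.radiusGrad a y)‖ ≤
          C₁' * Real.exp (-(κ * r)) * q :=
        (ContinuousLinearMap.opNorm_comp_le _ _).trans (by
          rw [ContinuousLinearMap.norm_toSpanSingleton]
          exact mul_le_mul hu1' hdr (norm_nonneg _) (by positivity))
      calc ‖𝒮 ℓ‖ * ‖(ContinuousLinearMap.toSpanSingleton ℝ (deriv u r)).comp (Kerr.radiusGrad a y)‖
          ≤ A * (C₁' * Real.exp (-(κ * r)) * q) := mul_le_mul h𝒮ℓ h3 (norm_nonneg _) hA0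
        _ = C₁' * Real.exp (-(κ * r)) * A * q := by ring
    calc ‖u r • (fderiv ℝ 𝒮 ℓ).comp Lℓ‖ +
          ‖𝒮 ℓ • (ContinuousLinearMap.toSpanSingleton ℝ (deriv u r)).comp (Kerr.radiusGrad a y)‖
        ≤ C₁' * Real.exp (-(κ * r)) * A * Bℓ' + C₁' * Real.exp (-(κ * r)) * A * q := add_le_add h1 h2
      _ = C₁' * Real.exp (-(κ * r)) * A * (Bℓ' + q) := by ring
      _ ≤ D * Real.exp (-(κ * ‖y‖)) := hmain _ (by positivity) (by linarith)
  exact ⟨hval, hder⟩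

/-! ### Mode solutions (Thm. 1.2) ⟹ profile form ⟹ spacetime form ⟹ the barrier -/

/-- **Shlapentokh-Rothman's mode theorem: existence of mode solutions (Thm. 1.2, ODE level) ⟹
profile form.** If for every sub-extremal `0 < |a| < M`, `m ≠ 0` and `δ > 0` there are `μ > 0` with
`|μ − |am|/(2Mr₊)| < δ` and `ω` with `Im ω > 0`, `Re ω ≠ 0`, `2Mr₊|ω| < |am|` admitting a mode solution
in the sense of SR §2 (`ModeSolution M a μ ω m` — this hypothesis is exactly what Theorem 1.2 of
Shlapentokh-Rothman, read through the definitions of §2 and with the mass clause of Thm. 1.1,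
asserts), then `ShlapentokhRothman2014_unstableModeProfile` holds: the Kerr–Schild profile
`Φ = modeProfile a ω f 𝒮` of the mode is `C^∞` on the exterior slice (`contDiffOn_modeProfile`), not
identically zero (`modeProfile_ne_zero`), exponentially decaying with its differential
(`modeProfile_decay`) and solves `P_ω Φ = μ² Φ` there (`reducedWaveOp_modeProfile`: Carter's
separation in Kerr's ingoing spheroidal coordinates and continuity across the axis).
SR, CMP 329 (2014), Thm. 1.2 and §2. [cite: ShlapentokhRothman2014KleinGordon, Thm. 1.2 and §2] -/
theorem ShlapentokhRothman2014_unstableModeProfile.of_modeSolutions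
    (h : ∀ (M a : ℝ), Kerr.IsSubextremal M a → a ≠ 0 → ∀ m : ℤ, m ≠ 0 → ∀ δ > (0 : ℝ),
      ∃ μ > (0 : ℝ), |μ - |a * m| / (2 * M * Kerr.rPlus M a)| < δ ∧
      ∃ w : ℂ, 0 < w.im ∧ w.re ≠ 0 ∧ 2 * M * Kerr.rPlus M a * ‖w‖ < |a * m| ∧
        Nonempty (ModeSolution M a μ w m)) :
    ShlapentokhRothman2014_unstableModeProfile := by
  intro _ _ M a hMa ha m hm δ hδ
  obtain ⟨μ, hμ, hμδ, w, hwim, hwre, hsup, ⟨d⟩⟩ := h M a hMa ha m hm δ hδ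
  have hrp : 0 < Kerr.rPlus M a := hMa.rPlus_pos
  refine ⟨μ, hμ, hμδ, w, hwim, hwre, hsup, modeProfile a w d.f d.𝒮,
    contDiffOn_modeProfile w d.contDiffAt_f d.isOpen_U d.sphere_subset_U d.contDiffOn_𝒮, ?_, ?_,
    reducedWaveOp_modeProfile hMa d.contDiffOn_S d.angularODE d.isOpen_U d.sphere_subset_U
      d.contDiffOn_𝒮 d.𝒮_sphRadial d.contDiffOn_R d.radialODE d.hasDerivAt_tbar_phibar
      d.contDiffAt_f d.R_eq⟩
  · -- not identically zero
    obtain ⟨θ₀, hθ₀, hSθ₀⟩ := d.S_ne_zero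
    obtain ⟨r₀, hr₀, hRr₀⟩ := d.R_ne_zero
    have hr₀' : Kerr.rPlus M a < r₀ := hr₀
    have hr₀pos : 0 < r₀ := hrp.trans hr₀'
    have hfr₀ : d.f r₀ ≠ 0 := by
      intro h0
      apply hRr₀
      rw [d.R_eq r₀ hr₀, h0, mul_zero]
    refine ⟨kerrStar a r₀ θ₀ 0, ?_, modeProfile_ne_zero w d.𝒮_sphRadial hr₀pos hθ₀ hSθ₀ hfr₀⟩
    exact kerrStar_mem_slice (by rw [max_eq_left hrp.le]; exact hr₀') θ₀ 0
  · -- bound-state decay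
    obtain ⟨C', hC'⟩ := modeProfile_decay hMa hwim (m := m) d.κ_pos d.hasDerivAt_tbar_phibar
      d.contDiffAt_f d.R_eq d.contDiffOn_R d.decay d.isOpen_U d.sphere_subset_U d.contDiffOn_𝒮
    exact ⟨C', d.κ, d.κ_pos, hC'⟩

/-- **Mode solutions (Thm. 1.2) ⟹ the barrier fact `KleinGordonSuperradiantInstability`** (Thm. 1.1,
vendored energy form): composition with `KleinGordonSuperradiantInstability.of_unstableModeProfile`.
With this, the only unproved input of the barrier is Shlapentokh-Rothman's analysis of the ODEs
(2.1)–(2.2) producing mode solutions with `Im ω > 0` (the hypothesis). SR, CMP 329 (2014), Thm. 1.1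
from Thm. 1.2. [cite: ShlapentokhRothman2014KleinGordon, Thm. 1.1 and Thm. 1.2] -/
theorem KleinGordonSuperradiantInstability.of_modeSolutions
    (h : ∀ (M a : ℝ), Kerr.IsSubextremal M a → a ≠ 0 → ∀ m : ℤ, m ≠ 0 → ∀ δ > (0 : ℝ),
      ∃ μ > (0 : ℝ), |μ - |a * m| / (2 * M * Kerr.rPlus M a)| < δ ∧
      ∃ w : ℂ, 0 < w.im ∧ w.re ≠ 0 ∧ 2 * M * Kerr.rPlus M a * ‖w‖ < |a * m| ∧
        Nonempty (ModeSolution M a μ w m)) :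
    KleinGordonSuperradiantInstability :=
  KleinGordonSuperradiantInstability.of_unstableModeProfile
    (ShlapentokhRothman2014_unstableModeProfile.of_modeSolutions h)

end Literature.Barriers.FinalStateConjecture

end
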